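import Literature.MathematicalPhysics.QuantumFieldTheory.Balaban1983to89.B6CutoffSupportKLevelV1
import Literature.MathematicalPhysics.QuantumFieldTheory.Balaban1983to89.B6IMSTermsV1
import Literature.MathematicalPhysics.QuantumFieldTheory.Balaban1983to89.B6QFormDgL2KLevelV1
import HarnessLib

/-!
# `Balaban1983to89.B6IMSTermsKLevelV1` — T. Bałaban, *Propagators and renormalization transformations for lattice gauge theories. II*,
Commun. Math. Phys. **96** (1984) 223–250 [Balaban1984PropagatorsII], Prop. 2.6 (2.140) p. 247 with (2.5) p. 224, (2.18) p. 226, (2.88) p. 238,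
Lemma 2.1 (2.61) p. 234: **THE TERMS OF THE LOCALISED ENERGY IDENTITY ON THE k-LEVEL V1 TORUS FAMILY, EACH `≤ C·e^{−2δ d_T(y,y′)}‖u‖²`** — file F4c
of the interior-energy route to (2.140)₄ (census slot hl3 of `B6Prop26PrintedStage2KLevelV1.prop26Printed_kLevel_of_slots5`; cell pub-ymgap, seat
dag-p1, `HOME/pub-ymgap-dag-p1/HL3-PLAN.md`; lit-balaban GAPS G-B6-2140-456).
HONEST FRAMING (programme rule): statement-level skeleton of published theorems with citation tags; proofs where landed; nothing here is a claim about
the Yang–Mills mass gap.  Finite-lattice `ℓ²` bookkeeping combining r03's `q_i` support/size facts, the `ℓ²` form bounds of `B6QFormDgL2KLevelV1` and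
the block counts of `B6CutoffSupportKLevelV1`; every length and `c_f = L^k η` factor cancels identically; no estimate of print is asserted; THEOREMS
ONLY; nothing continuum ∕ mass-gap ∕ Clay.
WHAT IS PROVED (0 sorry; standard axioms), for a bond function `v` obeying the block bound `‖Δ(y₂)v‖ ≤ A₂ℓ(y₂)|c_f|⁻¹e^{−δ_H d_T(y₂,y′)}U` (the shape
of (2.140)₂ for `v = G∇*u`, `supp u ⊂ Δ(y′)`) and a cut-off `χ` living within `d_T ≤ r` of `y`: §1 `sum_sq_blk_eq`, **`sum_sq_near_le`** (`Σ_{d_T(Δ(b),y)≤r}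
v(b)² ≤ e^{ar}K·(A₂Lℓ(y)|c_f|⁻¹e^{δ_H r}e^{−δ_H d}U)²`); §2 **`TQ_le`** (the `⟨Q(χ²v), aQv⟩` term); §3 **`TP_le`** (the `⟨χ²v, ∂P∂*v⟩` term through the
`ℓ²` majorant of (2.88)).  Seat `pub-ymgap-dag-p1` (prover), 2026-08-25.  NOT summit progress.
-/

open scoped BigOperators InnerProductSpace

noncomputable section

namespace Literature.MathematicalPhysics.QuantumFieldTheory.Balaban1983to89.B6IMSTermsKLevelV1

open Finset
open LatticeFieldCalculus B6SectAOperatorsV1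
open B6MultiLevelBoxOperator (N0)
open B6MultiLevelTorusOperator (TDomains)
open B6Geom246MultiLevelBox (bset)
open B6Geom246MultiLevelTorus (geomT triangle_refl_nonneg_T)
open B6GlobalChartV1 (PV domT blkV1)
open B6Ineq2142KLevelV1 (lvl β qwt qwt_nonneg beta_level metBlocks card_metBlocks_le)
open B6CubeWindowV1 (GlobalBand)
open B6Lemma21Repaired (Ineq261With)
open B6RandomWalk (blockPiece)
open B6RandomWalkL2 (l2n l2n_sq l2n_nonneg blockPiece_off HasL2Majorant)
open B8Ineq192MultiLevelTorus (symmT)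
open B6CutoffSupportKLevelV1 (exists_qwt_ne_zero_of_QE_ne_zero blkV1_mem_metBlocks dist_beta_le_of_mem_metBlocks sum_ind_dist_le
  sum_ind_dist_beta_le)
open B6BlockRunsKLevelV1 (level_window_of_dist_lt)
open B6IMSTermsV1 (abs_sum_mul_apply_le l2n_blockPiece_mono l2n_blockPiece_eq_zero)
open B6QFormDgL2KLevelV1 (abs_inner_QaQ_le)
open Literature.MathematicalPhysics.QuantumFieldTheory.BalabanImbrieJaffe1984to88.BIJ85AxialPropagator411 (BondSpace)

variable {d ℓ m K : ℕ} {hd : 1 ≤ d + 1} {hL : Odd (ℓ + 1) ∧ 1 < ℓ + 1} {Mh k R : ℕ} {P' : Fin (d + 1) → ℕ}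
variable (hN : ∀ μ, N0 ℓ Mh k P' μ = (PV d ℓ m K hd hL).sitesPerDir 0) (D : TDomains d ℓ Mh k P' R) (hk : k ≤ m + K)

/-! ## §1  Sums of `v²` over the bonds of nearby blocks -/

omit hk in
/-- regrouping a bond sum by blocks: `Σ_{b : Δ(b) ∈ M} v(b)² = Σ_{y₂ ∈ M} ‖Δ(y₂)v‖²`. [cite: Balaban1984PropagatorsII, (2.52) p.232, bookkeeping] -/
theorem sum_sq_blk_eq (M : ↥(bset D.toDomains) → Prop) [DecidablePred M] (v : PBond (PV d ℓ m K hd hL) 0 → ℝ) :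
    ∑ b, (if M (blkV1 hN D b) then v b ^ 2 else 0) =
      ∑ y₂ : ↥(bset D.toDomains), (if M y₂ then l2n (blockPiece (g := geomT D) (blkV1 hN D) y₂ v) ^ 2 else 0) := by
  classical
  calc ∑ b, (if M (blkV1 hN D b) then v b ^ 2 else 0)
      = ∑ b, ∑ y₂ : ↥(bset D.toDomains), (if blkV1 hN D b = y₂ then (if M y₂ then v b ^ 2 else 0) else 0) := by
        refine Finset.sum_congr rfl fun b _ => ?_
        rw [Finset.sum_ite_eq]; simp
    _ = ∑ y₂ : ↥(bset D.toDomains), ∑ b, (if blkV1 hN D b = y₂ then (if M y₂ then v b ^ 2 else 0) else 0) := Finset.sum_comm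
    _ = _ := by
        refine Finset.sum_congr rfl fun y₂ _ => ?_
        split_ifs with hM
        · rw [l2n_sq]; refine Finset.sum_congr rfl fun b _ => ?_
          by_cases h : blkV1 hN D b = y₂
          · rw [if_pos h]; simp [blockPiece, h]
          · rw [if_neg h, blockPiece_off (g := geomT D) (blkV1 hN D) y₂ v b h]; ring
        · simp

omit hk in
/-- **`Σ_{d_T(Δ(b),y) ≤ r} v(b)² ≤ e^{ar}K·(A₂·L·L^{j(y)}|c_f|⁻¹·e^{δ_H r}·e^{−δ_H d_T(y,y′)}·U)²`** for `v` with the block bound of (2.140)₂ and `r` inside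
the level window. [cite: Balaban1984PropagatorsII, Prop. 2.6 (2.140) p.247, Lemma 2.1 (2.61) p.234, (2.2) p.224] -/
theorem sum_sq_near_le (hMh : 1 ≤ Mh) (hP : ∀ μ, 1 ≤ P' μ) {Kc a : ℝ} (h261 : Ineq261With Kc (geomT D) a 1) (ha : 0 ≤ a)
    (y y' : ↥(bset D.toDomains)) {r : ℝ} (hr : r < ((R * ((ℓ + 1) * Mh) - 1 : ℕ) : ℝ)) (v : PBond (PV d ℓ m K hd hL) 0 → ℝ)
    {cf A₂ δH U : ℝ} (hA₂ : 0 ≤ A₂) (hδH : 0 ≤ δH) (hU : 0 ≤ U)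
    (hHv : ∀ y₂ : ↥(bset D.toDomains), l2n (blockPiece (g := geomT D) (blkV1 hN D) y₂ v) ≤
      A₂ * (((ℓ : ℝ) + 1) ^ y₂.1.1 * |cf|⁻¹) * Real.exp (-(δH * (geomT D).dist y₂ y')) * U) :
    ∑ b, (if (geomT D).dist (blkV1 hN D b) y ≤ r then v b ^ 2 else 0) ≤
      Real.exp (a * r) * Kc * (A₂ * (((ℓ : ℝ) + 1) * ((ℓ : ℝ) + 1) ^ y.1.1 * |cf|⁻¹) * Real.exp (δH * r) *
        Real.exp (-(δH * (geomT D).dist y y')) * U) ^ 2 := by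
  classical
  have htri := (triangle_refl_nonneg_T D hMh hP).1
  have hL0 : (0 : ℝ) < (ℓ : ℝ) + 1 := by positivity
  set Mb : ℝ := A₂ * (((ℓ : ℝ) + 1) * ((ℓ : ℝ) + 1) ^ y.1.1 * |cf|⁻¹) * Real.exp (δH * r) *
    Real.exp (-(δH * (geomT D).dist y y')) * U
  rw [sum_sq_blk_eq hN D (fun y₂ => (geomT D).dist y₂ y ≤ r) v]
  have hterm : ∀ y₂ : ↥(bset D.toDomains),
      (if (geomT D).dist y₂ y ≤ r then l2n (blockPiece (g := geomT D) (blkV1 hN D) y₂ v) ^ 2 else 0) ≤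
      (if (geomT D).dist y₂ y ≤ r then (1 : ℝ) else 0) * Mb ^ 2 := by
    intro y₂
    split_ifs with hy₂
    · rw [one_mul]
      refine pow_le_pow_left₀ (l2n_nonneg _) ((hHv y₂).trans ?_) 2
      have hw := level_window_of_dist_lt D hMh hP y₂ y (lt_of_le_of_lt hy₂ hr)
      have hlen : ((ℓ : ℝ) + 1) ^ y₂.1.1 ≤ ((ℓ : ℝ) + 1) * ((ℓ : ℝ) + 1) ^ y.1.1 := by
        rw [← pow_succ']; exact pow_le_pow_right₀ (by linarith) (by omega)
      have hexp : Real.exp (-(δH * (geomT D).dist y₂ y')) ≤ Real.exp (δH * r) * Real.exp (-(δH * (geomT D).dist y y')) := by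
        rw [← Real.exp_add]; apply Real.exp_le_exp.2
        have h1 := htri y y₂ y'
        rw [symmT D y y₂] at h1
        nlinarith [mul_le_mul_of_nonneg_left h1 hδH, mul_le_mul_of_nonneg_left hy₂ hδH]
      have hi : 0 ≤ |cf|⁻¹ := inv_nonneg.2 (abs_nonneg _)
      calc A₂ * (((ℓ : ℝ) + 1) ^ y₂.1.1 * |cf|⁻¹) * Real.exp (-(δH * (geomT D).dist y₂ y')) * U
          ≤ A₂ * (((ℓ : ℝ) + 1) * ((ℓ : ℝ) + 1) ^ y.1.1 * |cf|⁻¹) *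
              (Real.exp (δH * r) * Real.exp (-(δH * (geomT D).dist y y'))) * U := by
            gcongr
        _ = Mb := by simp only [Mb]; ring
    · rw [zero_mul]
  refine (Finset.sum_le_sum fun y₂ _ => hterm y₂).trans ?_
  rw [← Finset.sum_mul]
  exact mul_le_mul_of_nonneg_right (sum_ind_dist_le D h261 ha y r) (sq_nonneg _)

/-! ## §2  The term `⟨Q(χ²v), aQv⟩` -/

/-- **THE `Q*aQ` TERM**: `|⟨Q(χ²v), aQv⟩| ≤ b₁·(2(d+1)e^{a(r+L+2)}K)·(L²·2L^{d+1}·(A₂L e^{δ_H(r+2L+4)})²)·e^{−2δ_H d_T(y,y′)}·U²` — the factors `c_f²` of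
`a ≤ b₁L^{−2j}ξ = b₁(c_f/L^j)²` and `L^{2j(y)}|c_f|⁻²` of the block bound cancel against the level window `L^{j(i)} ≥ L^{j(y)}/L`.
[cite: Balaban1984PropagatorsII, Prop. 2.6 (2.140) p.247, (2.5) p.224, (2.18) p.226, Lemma 2.1 (2.61) p.234] -/
theorem TQ_le (hMh : 1 ≤ Mh) (hP : ∀ μ, 1 ≤ P' μ) (hk1 : 1 ≤ k) (hRM2 : 2 ≤ R * Mh) {Kc a : ℝ}
    (h261 : Ineq261With Kc (geomT D) a 1) (ha : 0 ≤ a) {b₀ b₁ cf : ℝ} {w : BondIdx (domT hN D hk) → ℝ} (hwb : GlobalBand b₀ b₁ cf w)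
    (hcf : cf ≠ 0) (hw : ∀ i, 0 ≤ w i) (hb₁ : 0 ≤ b₁) (y y' : ↥(bset D.toDomains)) {r : ℝ}
    (hr : r + 2 * ℓ + 6 < ((R * ((ℓ + 1) * Mh) - 1 : ℕ) : ℝ)) (χ v : PBond (PV d ℓ m K hd hL) 0 → ℝ)
    (hχ01 : ∀ f, 0 ≤ χ f ∧ χ f ≤ 1) (hχs : ∀ f, χ f ≠ 0 → (geomT D).dist (blkV1 hN D f) y ≤ r)
    {A₂ δH U : ℝ} (hA₂ : 0 ≤ A₂) (hδH : 0 ≤ δH) (hU : 0 ≤ U)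
    (hHv : ∀ y₂ : ↥(bset D.toDomains), l2n (blockPiece (g := geomT D) (blkV1 hN D) y₂ v) ≤
      A₂ * (((ℓ : ℝ) + 1) ^ y₂.1.1 * |cf|⁻¹) * Real.exp (-(δH * (geomT D).dist y₂ y')) * U) :
    |⟪QE (domT hN D hk) (WithLp.toLp 2 fun b => χ b ^ 2 * v b : BondSpace (PV d ℓ m K hd hL)),
        aE (domT hN D hk) w (QE (domT hN D hk) (WithLp.toLp 2 v))⟫_ℝ| ≤
      b₁ * (2 * ((d : ℝ) + 1) * (Real.exp (a * (r + ℓ + 3)) * Kc)) *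
        ((((ℓ : ℝ) + 1)) ^ 2 * (2 * (((ℓ + 1 : ℕ) : ℝ)) ^ (d + 1)) *
          (A₂ * ((ℓ : ℝ) + 1) * Real.exp (δH * (r + 2 * ℓ + 6))) ^ 2) *
        Real.exp (-(2 * δH * (geomT D).dist y y')) * U ^ 2 := by
  classical
  have htri := (triangle_refl_nonneg_T D hMh hP).1
  have hL0 : (0 : ℝ) < (ℓ : ℝ) + 1 := by positivity
  have hLc : (((ℓ + 1 : ℕ) : ℝ)) = (ℓ : ℝ) + 1 := by push_cast; ring
  have hacf : 0 < |cf| := abs_pos.2 hcf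
  -- F2's form bound
  have hBA : ∀ f, |(WithLp.toLp 2 fun b => χ b ^ 2 * v b : BondSpace (PV d ℓ m K hd hL)) f| ≤ |(WithLp.toLp 2 v : BondSpace _) f| := by
    intro f
    change |χ f ^ 2 * v f| ≤ |v f|
    rw [abs_mul]
    have h1 : |χ f ^ 2| ≤ 1 := by
      rw [abs_of_nonneg (sq_nonneg _)]; nlinarith [(hχ01 f).1, (hχ01 f).2]
    calc |χ f ^ 2| * |v f| ≤ 1 * |v f| := mul_le_mul_of_nonneg_right h1 (abs_nonneg _)
      _ = |v f| := one_mul _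
  have hF2 := abs_inner_QaQ_le hN D hk hwb hcf hw (WithLp.toLp 2 v) (WithLp.toLp 2 fun b => χ b ^ 2 * v b) hBA
  refine hF2.trans ?_
  -- the uniform bound of one `i`-term and the count of the `i` that contribute
  set Mi : ℝ := (((ℓ : ℝ) + 1)) ^ 2 * (2 * (((ℓ + 1 : ℕ) : ℝ)) ^ (d + 1)) *
      (A₂ * ((ℓ : ℝ) + 1) * Real.exp (δH * (r + 2 * ℓ + 6))) ^ 2 * Real.exp (-(2 * δH * (geomT D).dist y y')) * U ^ 2 with hMi
  have hMi0 : 0 ≤ Mi := by positivity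
  have hterm : ∀ i : BondIdx (domT hN D hk),
      (if QE (domT hN D hk) (WithLp.toLp 2 fun b => χ b ^ 2 * v b : BondSpace (PV d ℓ m K hd hL)) i = 0 then (0 : ℝ) else
        (cf / (((ℓ + 1 : ℕ) : ℝ)) ^ (lvl hN D hk i)) ^ 2 *
          ∑ f, (if qwt hN D hk i f = 0 then 0 else (WithLp.toLp 2 v : BondSpace (PV d ℓ m K hd hL)) f ^ 2)) ≤
      (if (geomT D).dist (β hN D hk i) y ≤ r + ℓ + 3 then (1 : ℝ) else 0) * Mi := by
    intro i
    split_ifs with h0 hnear hnear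
    · rw [one_mul]; exact hMi0
    · simp
    · -- the contributing case
      rw [one_mul]
      -- size of the weight `(c_f / L^{j(i)})² ≤ (c_f L / L^{j(y)})²`
      have hwin_i : (geomT D).dist (β hN D hk i) y < ((R * ((ℓ + 1) * Mh) - 1 : ℕ) : ℝ) := by linarith
      have hw_i := level_window_of_dist_lt D hMh hP _ y hwin_i
      rw [beta_level hN D hk hk1] at hw_i
      have hLpow : 0 < (((ℓ + 1 : ℕ) : ℝ)) ^ (lvl hN D hk i) := by positivity
      have hly : 0 < ((ℓ : ℝ) + 1) ^ y.1.1 := by positivity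
      have hlv : ((ℓ : ℝ) + 1) ^ y.1.1 ≤ ((ℓ : ℝ) + 1) * (((ℓ + 1 : ℕ) : ℝ)) ^ (lvl hN D hk i) := by
        rw [hLc, ← pow_succ']; exact pow_le_pow_right₀ (by linarith) (by omega)
      have hw2 : (cf / (((ℓ + 1 : ℕ) : ℝ)) ^ (lvl hN D hk i)) ^ 2 ≤ (cf * ((ℓ : ℝ) + 1) / ((ℓ : ℝ) + 1) ^ y.1.1) ^ 2 := by
        rw [div_pow, div_pow, div_le_div_iff₀ (pow_pos hLpow 2) (pow_pos hly 2)]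
        have h3 := pow_le_pow_left₀ hly.le hlv 2
        calc cf ^ 2 * (((ℓ : ℝ) + 1) ^ y.1.1) ^ 2 ≤ cf ^ 2 * ((((ℓ : ℝ) + 1)) * (((ℓ + 1 : ℕ) : ℝ)) ^ (lvl hN D hk i)) ^ 2 :=
              mul_le_mul_of_nonneg_left h3 (sq_nonneg _)
          _ = (cf * ((ℓ : ℝ) + 1)) ^ 2 * ((((ℓ + 1 : ℕ) : ℝ)) ^ (lvl hN D hk i)) ^ 2 := by ring
      -- the `f`-sum through the met blocks
      have hsum : ∑ f, (if qwt hN D hk i f = 0 then (0 : ℝ) else (WithLp.toLp 2 v : BondSpace (PV d ℓ m K hd hL)) f ^ 2) ≤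
          ∑ f, (if blkV1 hN D f ∈ metBlocks hN D hk i then v f ^ 2 else 0) :=
        Finset.sum_le_sum fun f _ => by
          split_ifs with h1 h2 h2
          · positivity
          · exact le_rfl
          · exact le_of_eq rfl
          · exact absurd (blkV1_mem_metBlocks hN D hk i h1) h2
      have hsum' := hsum.trans (le_of_eq (sum_sq_blk_eq hN D (fun y₂ => y₂ ∈ metBlocks hN D hk i) v))
      -- each met block: `‖Δ(y₂)v‖² ≤ (A₂ L L^{j(y)} |c_f|⁻¹ e^{δ_H(r+2L+4)} e^{−δ_H d} U)²`
      set My : ℝ := A₂ * (((ℓ : ℝ) + 1) * ((ℓ : ℝ) + 1) ^ y.1.1 * |cf|⁻¹) * Real.exp (δH * (r + 2 * ℓ + 6)) *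
        Real.exp (-(δH * (geomT D).dist y y')) * U with hMy
      have hmet : ∀ y₂ ∈ metBlocks hN D hk i, l2n (blockPiece (g := geomT D) (blkV1 hN D) y₂ v) ^ 2 ≤ My ^ 2 := by
        intro y₂ hy₂
        have hd2 := dist_beta_le_of_mem_metBlocks hN D hk hk1 hRM2 hMh hP i hy₂
        have hd2y : (geomT D).dist y₂ y ≤ r + 2 * ℓ + 6 := by
          have t := htri y₂ (β hN D hk i) y
          rw [symmT D y₂ (β hN D hk i)] at t
          linarith
        refine pow_le_pow_left₀ (l2n_nonneg _) ((hHv y₂).trans ?_) 2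
        have hw := level_window_of_dist_lt D hMh hP y₂ y (hd2y.trans_lt (by linarith))
        have hlen : ((ℓ : ℝ) + 1) ^ y₂.1.1 ≤ ((ℓ : ℝ) + 1) * ((ℓ : ℝ) + 1) ^ y.1.1 := by
          rw [← pow_succ']; exact pow_le_pow_right₀ (by linarith) (by omega)
        have hexp : Real.exp (-(δH * (geomT D).dist y₂ y')) ≤
            Real.exp (δH * (r + 2 * ℓ + 6)) * Real.exp (-(δH * (geomT D).dist y y')) := by
          rw [← Real.exp_add]; apply Real.exp_le_exp.2
          have h1 := htri y y₂ y'
          rw [symmT D y y₂] at h1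
          nlinarith [mul_le_mul_of_nonneg_left h1 hδH, mul_le_mul_of_nonneg_left hd2y hδH]
        have hi : 0 ≤ |cf|⁻¹ := inv_nonneg.2 (abs_nonneg _)
        calc A₂ * (((ℓ : ℝ) + 1) ^ y₂.1.1 * |cf|⁻¹) * Real.exp (-(δH * (geomT D).dist y₂ y')) * U
            ≤ A₂ * (((ℓ : ℝ) + 1) * ((ℓ : ℝ) + 1) ^ y.1.1 * |cf|⁻¹) *
                (Real.exp (δH * (r + 2 * ℓ + 6)) * Real.exp (-(δH * (geomT D).dist y y'))) * U := by gcongr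
          _ = My := by simp only [hMy]; ring
      have hcard := card_metBlocks_le hN D hk hk1 hRM2 i
      have hsum2 : ∑ y₂ : ↥(bset D.toDomains),
          (if y₂ ∈ metBlocks hN D hk i then l2n (blockPiece (g := geomT D) (blkV1 hN D) y₂ v) ^ 2 else 0) ≤
          (2 * (((ℓ + 1 : ℕ) : ℝ)) ^ (d + 1)) * My ^ 2 := by
        rw [← Finset.sum_filter]
        calc ∑ y₂ ∈ Finset.univ.filter (fun y₂ : ↥(bset D.toDomains) => y₂ ∈ metBlocks hN D hk i),
              l2n (blockPiece (g := geomT D) (blkV1 hN D) y₂ v) ^ 2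
            ≤ ∑ y₂ ∈ Finset.univ.filter (fun y₂ : ↥(bset D.toDomains) => y₂ ∈ metBlocks hN D hk i), My ^ 2 :=
              Finset.sum_le_sum fun y₂ hy₂ => hmet y₂ (Finset.mem_filter.1 hy₂).2
          _ = ((metBlocks hN D hk i).card : ℝ) * My ^ 2 := by
              rw [Finset.sum_const, nsmul_eq_mul]
              congr 2
              exact congrArg Finset.card (Finset.filter_mem_eq_inter.trans (Finset.univ_inter _))
          _ ≤ (2 * (((ℓ + 1 : ℕ) : ℝ)) ^ (d + 1)) * My ^ 2 := by
              refine mul_le_mul_of_nonneg_right ?_ (sq_nonneg _)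
              exact_mod_cast hcard
      -- assemble the `i`-term: `c_f²` and `L^{2j(y)}` cancel
      have hkey : (cf * ((ℓ : ℝ) + 1) / ((ℓ : ℝ) + 1) ^ y.1.1) ^ 2 * ((2 * (((ℓ + 1 : ℕ) : ℝ)) ^ (d + 1)) * My ^ 2) = Mi := by
        simp only [hMi, hMy]
        field_simp
        rw [show |cf| ^ 2 = cf ^ 2 from sq_abs cf, show Real.exp (-(2 * δH * (geomT D).dist y y')) =
          Real.exp (-(δH * (geomT D).dist y y')) ^ 2 by rw [← Real.exp_nat_mul]; ring_nf]
        ring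
      calc (cf / (((ℓ + 1 : ℕ) : ℝ)) ^ (lvl hN D hk i)) ^ 2 *
            ∑ f, (if qwt hN D hk i f = 0 then (0 : ℝ) else (WithLp.toLp 2 v : BondSpace (PV d ℓ m K hd hL)) f ^ 2)
          ≤ (cf * ((ℓ : ℝ) + 1) / ((ℓ : ℝ) + 1) ^ y.1.1) ^ 2 * ((2 * (((ℓ + 1 : ℕ) : ℝ)) ^ (d + 1)) * My ^ 2) :=
            mul_le_mul hw2 (hsum'.trans hsum2) (Finset.sum_nonneg fun f _ => by split_ifs <;> positivity) (sq_nonneg _)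
        _ = Mi := hkey
    · -- `(Q(χ²v))_i ≠ 0` but `β i` far from `y`: impossible
      exfalso
      obtain ⟨f₀, hq₀, hχ₀⟩ := exists_qwt_ne_zero_of_QE_ne_zero hN D hk χ v i h0
      have h1 := dist_beta_le_of_mem_metBlocks hN D hk hk1 hRM2 hMh hP i (blkV1_mem_metBlocks hN D hk i hq₀)
      have h2 := hχs f₀ hχ₀
      exact hnear (by linarith [htri (β hN D hk i) (blkV1 hN D f₀) y])
  calc b₁ * ∑ i, (if QE (domT hN D hk) (WithLp.toLp 2 fun b => χ b ^ 2 * v b : BondSpace (PV d ℓ m K hd hL)) i = 0 then (0 : ℝ) else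
          (cf / (((ℓ + 1 : ℕ) : ℝ)) ^ (lvl hN D hk i)) ^ 2 *
            ∑ f, (if qwt hN D hk i f = 0 then 0 else (WithLp.toLp 2 v : BondSpace (PV d ℓ m K hd hL)) f ^ 2))
      ≤ b₁ * ∑ i, (if (geomT D).dist (β hN D hk i) y ≤ r + ℓ + 3 then (1 : ℝ) else 0) * Mi :=
        mul_le_mul_of_nonneg_left (Finset.sum_le_sum fun i _ => hterm i) hb₁
    _ = b₁ * ((∑ i, (if (geomT D).dist (β hN D hk i) y ≤ r + ℓ + 3 then (1 : ℝ) else 0)) * Mi) := by rw [Finset.sum_mul]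
    _ ≤ b₁ * ((2 * ((d : ℝ) + 1) * (Real.exp (a * (r + ℓ + 3)) * Kc)) * Mi) :=
        mul_le_mul_of_nonneg_left (mul_le_mul_of_nonneg_right (sum_ind_dist_beta_le hN D hk hk1 h261 ha y _) hMi0) hb₁
    _ = _ := by simp only [hMi]; ring

/-! ## §3  The term `⟨χ²v, ∂P∂*v⟩` -/

omit hk in
/-- **THE `∂P∂*` TERM** through an `ℓ²` block majorant `c_f²(d+1)C/(ℓ(y₁)ℓ(y₂))·e^{−δ_P d_T(y₁,y₂)}` of `S = ∂(1−R)∂*` (the shape of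
`B6QFormDgL2KLevelV1.hasL2Majorant_Dg_V1`): `|Σ_b χ²v·Sv| ≤ e^{ar}K·(A₂²(d+1)CK)·e^{(δ_H+δ_e)r}·e^{−(δ_H+δ_e)d_T(y,y′)}·U²` whenever `a + δ_e ≤ δ_P`,
`δ_e ≤ δ_H` — the length `ℓ(y₂)` and the factor `c_f²·|c_f|⁻²` cancel identically.
[cite: Balaban1984PropagatorsII, Prop. 2.6 (2.140) p.247, (2.88) p.238, Lemma 2.1 (2.61) p.234] -/
theorem TP_le (hMh : 1 ≤ Mh) (hP : ∀ μ, 1 ≤ P' μ) {Kc a : ℝ} (h261 : Ineq261With Kc (geomT D) a 1) (ha : 0 ≤ a)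
    (y y' : ↥(bset D.toDomains)) {r : ℝ} (χ v : PBond (PV d ℓ m K hd hL) 0 → ℝ)
    (hχ01 : ∀ f, 0 ≤ χ f ∧ χ f ≤ 1) (hχs : ∀ f, χ f ≠ 0 → (geomT D).dist (blkV1 hN D f) y ≤ r)
    {S : Module.End ℝ (PBond (PV d ℓ m K hd hL) 0 → ℝ)} {cf C δP δe : ℝ} (hcf : cf ≠ 0) (hC : 0 ≤ C) (hδe : 0 ≤ δe)
    (haP : a + δe ≤ δP)
    (hS : HasL2Majorant (g := geomT D) (blkV1 hN D) S (fun y₁ y₂ => cf ^ 2 * ((d : ℝ) + 1) * C /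
      ((geomT D).len y₁ * (geomT D).len y₂) * Real.exp (-(δP * (geomT D).dist y₁ y₂))))
    {A₂ δH U : ℝ} (hA₂ : 0 ≤ A₂) (hδH : δe ≤ δH) (hU : 0 ≤ U)
    (hHv : ∀ y₂ : ↥(bset D.toDomains), l2n (blockPiece (g := geomT D) (blkV1 hN D) y₂ v) ≤
      A₂ * (((ℓ : ℝ) + 1) ^ y₂.1.1 * |cf|⁻¹) * Real.exp (-(δH * (geomT D).dist y₂ y')) * U) :
    |∑ b, χ b ^ 2 * v b * S v b| ≤
      Real.exp (a * r) * Kc * (A₂ ^ 2 * ((d : ℝ) + 1) * C * Kc) * Real.exp ((δH + δe) * r) *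
        Real.exp (-((δH + δe) * (geomT D).dist y y')) * U ^ 2 := by
  classical
  have htri := (triangle_refl_nonneg_T D hMh hP).1
  have hnn := (triangle_refl_nonneg_T D hMh hP).2.2
  have hL0 : (0 : ℝ) < (ℓ : ℝ) + 1 := by positivity
  have hacf : 0 < |cf| := abs_pos.2 hcf
  have hlen : ∀ z : ↥(bset D.toDomains), (geomT D).len z = ((ℓ : ℝ) + 1) ^ z.1.1 := fun z => by
    show ((ℓ : ℝ) + 1) ^ z.1.1 * 1 = _; rw [mul_one]
  have h0 := abs_sum_mul_apply_le (g := geomT D) (blkV1 hN D) hS (fun b => χ b ^ 2 * v b) v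
  refine h0.trans ?_
  -- the inner sum `Σ_{y₂} K(y₁,y₂)‖Δ(y₂)v‖ ≤ ((d+1)CA₂|c_f|U/L^{j₁})·e^{−δ_e d_T(y₁,y′)}·K`
  have hinner : ∀ y₁ : ↥(bset D.toDomains),
      ∑ y₂ : ↥(bset D.toDomains), cf ^ 2 * ((d : ℝ) + 1) * C / ((geomT D).len y₁ * (geomT D).len y₂) *
          Real.exp (-(δP * (geomT D).dist y₁ y₂)) * l2n (blockPiece (g := geomT D) (blkV1 hN D) y₂ v) ≤
        ((d : ℝ) + 1) * C * A₂ * |cf| * U / ((ℓ : ℝ) + 1) ^ y₁.1.1 * Real.exp (-(δe * (geomT D).dist y₁ y')) * Kc := by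
    intro y₁
    have hK0 : ∀ y₂ : ↥(bset D.toDomains), 0 ≤ cf ^ 2 * ((d : ℝ) + 1) * C / ((geomT D).len y₁ * (geomT D).len y₂) *
        Real.exp (-(δP * (geomT D).dist y₁ y₂)) := fun y₂ => by rw [hlen, hlen]; positivity
    have hstep : ∀ y₂ : ↥(bset D.toDomains),
        cf ^ 2 * ((d : ℝ) + 1) * C / ((geomT D).len y₁ * (geomT D).len y₂) * Real.exp (-(δP * (geomT D).dist y₁ y₂)) *
            l2n (blockPiece (g := geomT D) (blkV1 hN D) y₂ v) ≤
          ((d : ℝ) + 1) * C * A₂ * |cf| * U / ((ℓ : ℝ) + 1) ^ y₁.1.1 * Real.exp (-(δe * (geomT D).dist y₁ y')) *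
            Real.exp (-(a * (geomT D).dist y₁ y₂)) := by
      intro y₂
      refine (mul_le_mul_of_nonneg_left (hHv y₂) (hK0 y₂)).trans ?_
      rw [hlen, hlen]
      have hexp : Real.exp (-(δP * (geomT D).dist y₁ y₂)) * Real.exp (-(δH * (geomT D).dist y₂ y')) ≤
          Real.exp (-(δe * (geomT D).dist y₁ y')) * Real.exp (-(a * (geomT D).dist y₁ y₂)) := by
        rw [← Real.exp_add, ← Real.exp_add]; apply Real.exp_le_exp.2
        have h1 := htri y₁ y₂ y'
        have h2 := hnn y₁ y₂
        have h3 := hnn y₂ y'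
        nlinarith [mul_le_mul_of_nonneg_left h1 hδe, mul_le_mul_of_nonneg_right haP h2, mul_le_mul_of_nonneg_right hδH h3]
      have hid : cf ^ 2 * ((d : ℝ) + 1) * C / (((ℓ : ℝ) + 1) ^ y₁.1.1 * ((ℓ : ℝ) + 1) ^ y₂.1.1) *
            Real.exp (-(δP * (geomT D).dist y₁ y₂)) *
            (A₂ * (((ℓ : ℝ) + 1) ^ y₂.1.1 * |cf|⁻¹) * Real.exp (-(δH * (geomT D).dist y₂ y')) * U) =
          ((d : ℝ) + 1) * C * A₂ * |cf| * U / ((ℓ : ℝ) + 1) ^ y₁.1.1 *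
            (Real.exp (-(δP * (geomT D).dist y₁ y₂)) * Real.exp (-(δH * (geomT D).dist y₂ y'))) := by
        have hp1 : ((ℓ : ℝ) + 1) ^ y₂.1.1 ≠ 0 := pow_ne_zero _ hL0.ne'
        have hp2 : ((ℓ : ℝ) + 1) ^ y₁.1.1 ≠ 0 := pow_ne_zero _ hL0.ne'
        field_simp
        rw [show cf ^ 2 = |cf| ^ 2 from (sq_abs cf).symm]
        ring
      rw [hid]
      calc ((d : ℝ) + 1) * C * A₂ * |cf| * U / ((ℓ : ℝ) + 1) ^ y₁.1.1 *
            (Real.exp (-(δP * (geomT D).dist y₁ y₂)) * Real.exp (-(δH * (geomT D).dist y₂ y')))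
          ≤ ((d : ℝ) + 1) * C * A₂ * |cf| * U / ((ℓ : ℝ) + 1) ^ y₁.1.1 *
            (Real.exp (-(δe * (geomT D).dist y₁ y')) * Real.exp (-(a * (geomT D).dist y₁ y₂))) :=
            mul_le_mul_of_nonneg_left hexp (by positivity)
        _ = _ := (mul_assoc _ _ _).symm
    refine (Finset.sum_le_sum fun y₂ _ => hstep y₂).trans ?_
    rw [← Finset.mul_sum]
    have h261' := h261 y₁
    rw [one_mul] at h261'
    exact mul_le_mul_of_nonneg_left h261' (by positivity)
  -- the outer sum over the blocks `y₁` meeting the support of `χ`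
  have hKc : 0 ≤ Kc := le_trans (Finset.sum_nonneg fun _ _ => (Real.exp_pos _).le) (by have h := h261 y; rw [one_mul] at h; exact h)
  set Mo : ℝ := A₂ ^ 2 * ((d : ℝ) + 1) * C * Kc * Real.exp ((δH + δe) * r) * Real.exp (-((δH + δe) * (geomT D).dist y y')) * U ^ 2
    with hMo
  have hMo0 : 0 ≤ Mo := by positivity
  have houter : ∀ y₁ : ↥(bset D.toDomains),
      l2n (blockPiece (g := geomT D) (blkV1 hN D) y₁ (fun b => χ b ^ 2 * v b)) *
          ∑ y₂ : ↥(bset D.toDomains), cf ^ 2 * ((d : ℝ) + 1) * C / ((geomT D).len y₁ * (geomT D).len y₂) *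
            Real.exp (-(δP * (geomT D).dist y₁ y₂)) * l2n (blockPiece (g := geomT D) (blkV1 hN D) y₂ v) ≤
        (if (geomT D).dist y₁ y ≤ r then (1 : ℝ) else 0) * Mo := by
    intro y₁
    split_ifs with hnear
    · rw [one_mul]
      have hφ : l2n (blockPiece (g := geomT D) (blkV1 hN D) y₁ (fun b => χ b ^ 2 * v b)) ≤
          A₂ * (((ℓ : ℝ) + 1) ^ y₁.1.1 * |cf|⁻¹) * Real.exp (-(δH * (geomT D).dist y₁ y')) * U := by
        refine (l2n_blockPiece_mono (g := geomT D) (blkV1 hN D) y₁ fun b => ?_).trans (hHv y₁)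
        rw [abs_mul, abs_of_nonneg (sq_nonneg _)]
        have : χ b ^ 2 ≤ 1 := by nlinarith [(hχ01 b).1, (hχ01 b).2]
        calc χ b ^ 2 * |v b| ≤ 1 * |v b| := mul_le_mul_of_nonneg_right this (abs_nonneg _)
          _ = |v b| := one_mul _
      refine (mul_le_mul hφ (hinner y₁) (Finset.sum_nonneg fun y₂ _ => mul_nonneg (by rw [hlen, hlen]; positivity)
        (l2n_nonneg _)) (by positivity)).trans ?_
      have hexp : Real.exp (-(δH * (geomT D).dist y₁ y')) * Real.exp (-(δe * (geomT D).dist y₁ y')) ≤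
          Real.exp ((δH + δe) * r) * Real.exp (-((δH + δe) * (geomT D).dist y y')) := by
        rw [← Real.exp_add, ← Real.exp_add]; apply Real.exp_le_exp.2
        have h1 := htri y y₁ y'
        rw [symmT D y y₁] at h1
        have hδ0 : 0 ≤ δH + δe := by linarith
        nlinarith [mul_le_mul_of_nonneg_left h1 hδ0, mul_le_mul_of_nonneg_left hnear hδ0]
      have hp2 : ((ℓ : ℝ) + 1) ^ y₁.1.1 ≠ 0 := pow_ne_zero _ hL0.ne'
      have hid : A₂ * (((ℓ : ℝ) + 1) ^ y₁.1.1 * |cf|⁻¹) * Real.exp (-(δH * (geomT D).dist y₁ y')) * U *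
            (((d : ℝ) + 1) * C * A₂ * |cf| * U / ((ℓ : ℝ) + 1) ^ y₁.1.1 * Real.exp (-(δe * (geomT D).dist y₁ y')) * Kc) =
          A₂ ^ 2 * ((d : ℝ) + 1) * C * Kc * U ^ 2 *
            (Real.exp (-(δH * (geomT D).dist y₁ y')) * Real.exp (-(δe * (geomT D).dist y₁ y'))) := by
        field_simp
      rw [hid, hMo]
      calc A₂ ^ 2 * ((d : ℝ) + 1) * C * Kc * U ^ 2 * (Real.exp (-(δH * (geomT D).dist y₁ y')) * Real.exp (-(δe * (geomT D).dist y₁ y')))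
          ≤ A₂ ^ 2 * ((d : ℝ) + 1) * C * Kc * U ^ 2 * (Real.exp ((δH + δe) * r) * Real.exp (-((δH + δe) * (geomT D).dist y y'))) :=
            mul_le_mul_of_nonneg_left hexp (by positivity)
        _ = _ := by ring
    · -- `χ` vanishes on `Δ(y₁)`: the piece is `0`
      rw [zero_mul]
      have hz : l2n (blockPiece (g := geomT D) (blkV1 hN D) y₁ (fun b => χ b ^ 2 * v b)) = 0 := by
        refine l2n_blockPiece_eq_zero (g := geomT D) (blkV1 hN D) y₁ fun b hb => ?_
        have hχ0 : χ b = 0 := by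
          by_contra hne
          exact hnear (hb ▸ hχs b hne)
        rw [hχ0]; ring
      rw [hz, zero_mul]
  calc ∑ y₁ : ↥(bset D.toDomains), l2n (blockPiece (g := geomT D) (blkV1 hN D) y₁ (fun b => χ b ^ 2 * v b)) *
          ∑ y₂ : ↥(bset D.toDomains), cf ^ 2 * ((d : ℝ) + 1) * C / ((geomT D).len y₁ * (geomT D).len y₂) *
            Real.exp (-(δP * (geomT D).dist y₁ y₂)) * l2n (blockPiece (g := geomT D) (blkV1 hN D) y₂ v)
      ≤ ∑ y₁ : ↥(bset D.toDomains), (if (geomT D).dist y₁ y ≤ r then (1 : ℝ) else 0) * Mo := Finset.sum_le_sum fun y₁ _ => houter y₁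
    _ = (∑ y₁ : ↥(bset D.toDomains), (if (geomT D).dist y₁ y ≤ r then (1 : ℝ) else 0)) * Mo := by rw [Finset.sum_mul]
    _ ≤ Real.exp (a * r) * Kc * Mo := mul_le_mul_of_nonneg_right (sum_ind_dist_le D h261 ha y r) hMo0
    _ = _ := by simp only [hMo]; ring

end Literature.MathematicalPhysics.QuantumFieldTheory.Balaban1983to89.B6IMSTermsKLevelV1
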